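import Literature.NumberTheory.LFunctions.GreatestRealZeroElementary
import Literature.NumberTheory.LFunctions.DirichletConvOneChiSumSharp
import Literature.NumberTheory.Sieve.PolyaVinogradovOddCharacters
import HarnessLib

/-!
# Pintz 1976 (II), Lemma 1 — proof of the named fact `pintz1976_lemma1`

Topic `Literature/NumberTheory/LFunctions`. Everything in this file is PROVED (theorems only): the
discharge `pintz1976_lemma1_holds : pintz1976_lemma1` of the named fact of
`GreatestRealZeroElementary.lean` — J. Pintz, *Elementary methods in the theory of L-functions, II*,
Acta Arith. 31 (1976), Lemma 1 p. 279 (2.1): for a real non-principal (here: primitive) character `χ`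
mod `D` and `x ≥ 4√D log²D`,
`Σ_{n ≤ x} g(n)/n = L'(1) + (log x + γ)L(1) + 5ϑ√(√D log D log x/x)`, `g = 1 ∗ χ`, `|ϑ| ≤ 1`.

## The argument (pp. 279–280, with the constants repaired)

Pintz's proof is the hyperbola method with Abel's inequality on the three monotone weights `1/d`,
`log d/d`, `(1/d)Σ_{m ≤ x/d} 1/m` and an interval character-sum bound `|Σ_{a<d≤b} χ(d)| ≤ P`
("Pólya's inequality", p. 280). As recorded in the READING NOTE of the statement file, the displayed
error terms with Pólya's constant `5/3` add up to more than the printed `5`; the statement is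
nevertheless true, and we prove it AS PRINTED by running the same argument with sharp bookkeeping:

1. `DirichletConvOneChiSumSharp.lean` (this tree) gives, for `2 ≤ Y ≤ x`,
   `|Σ_{n≤x} g(n)/n − ((log x + γ)L(1) + L'(1))| ≤ P(2 log x + γ + 1)/(Y+1) + 2Y/x`
   (the `log(Y+1)` parts of the `log d/d`-tail and of `Σ₂` cancel — this is where the printed
   accounting loses).
2. The choice `Y = ⌊√(P(2 log x + γ + 1)x/2)⌋` gives the error `≤ 2√(2P(2 log x + γ + 1)/x)`
   (`exists_floor_le_two_sqrt`), admissible because `√D log D log x ≤ 0.625 x` in the printed range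
   (`sqrt_mul_log_mul_log_le`).
3. It remains that `8P(2 log x + γ + 1) ≤ 25 √D log D log x`, i.e. `P ≤ (25/8)√D log D ·
   log x/(2 log x + γ + 1)`. For `D ≤ 69` we use the trivial interval bound `P = D/2` (a block of `D`
   consecutive values sums to `0`; `norm_sum_Ioc_le_half`), for `D ≥ 70` the tree's explicit
   Pólya–Vinogradov inequality with Landau's constant `1/π`
   (`LargeSieve.polyaVinogradov_one_div_pi`: `P = √D log D/π + 2√D log log D/π + 2√D + 1`); the
   resulting numerical inequalities are checked on the ranges `[3,4]`, `[5,8]`, `[9,16]`, `[17,32]`,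
   `[33,69]`, `[70,∞)` from `log 2`, `e`, `π` to a few digits.

The hypothesis "`χ` real" (quadratic) of the named fact is not used: the estimate holds in norm for
every primitive `χ ≠ χ₀`.

## References

* [Pintz1976ElementaryII] J. Pintz, Acta Arith. 31 (1976) 273–289, Lemma 1 p. 279 (2.1), proof
  pp. 279–280. [cite: Pintz1976ElementaryII, Lemma 1 p. 279 (2.1)]
* [MontgomeryVaughan2007] §11.2.1 Exercise 3 (the hyperbola method for `Σ (1∗χ)(n)/n`).
* [Pomerance2011] §1 (2) (explicit Pólya–Vinogradov with the constant `1/π`, as vendored in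
  `Literature/NumberTheory/Sieve/PolyaVinogradovOddCharacters.lean`).
-/

noncomputable section

open Finset

namespace Literature.NumberTheory.LFunctions

open Pintz1976

/-! ### Numerical constants -/

/-- `k log 2 ≤ log D` for `2^k ≤ D`. [folklore] -/
private theorem log_ge_of_pow_le {D k : ℕ} (h : 2 ^ k ≤ D) : (k : ℝ) * Real.log 2 ≤ Real.log D := by
  rw [← Real.log_pow]
  exact Real.log_le_log (by positivity) (by exact_mod_cast h)

/-- `log 3 ≥ (3/2) log 2 ≥ 1.0397`. [folklore] -/
private theorem log_three_ge : (1.0397 : ℝ) ≤ Real.log 3 := by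
  have h : Real.log ((2 : ℝ) ^ 3) ≤ Real.log ((3 : ℝ) ^ 2) :=
    Real.log_le_log (by norm_num) (by norm_num)
  rw [Real.log_pow, Real.log_pow] at h
  push_cast at h
  linarith [Real.log_two_gt_d9]

/-- `log D ≥ 1.0397` for `D ≥ 3`. [folklore] -/
private theorem log_ge_of_three_le {D : ℕ} (hD : 3 ≤ D) : (1.0397 : ℝ) ≤ Real.log D :=
  log_three_ge.trans (Real.log_le_log (by norm_num) (by exact_mod_cast hD))

/-- `s ≤ √D` from `s² ≤ D`. [folklore] -/
private theorem le_sqrt_of_sq_le {D : ℕ} {s : ℝ} (hs : 0 ≤ s) (h : s ^ 2 ≤ (D : ℝ)) :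
    s ≤ Real.sqrt D := by
  rw [← Real.sqrt_sq hs]; exact Real.sqrt_le_sqrt h

/-- `√D ≤ s` from `D ≤ s²`. [folklore] -/
private theorem sqrt_le_of_le_sq {D : ℕ} {s : ℝ} (hs : 0 ≤ s) (h : (D : ℝ) ≤ s ^ 2) :
    Real.sqrt D ≤ s := by
  rw [← Real.sqrt_sq hs]; exact Real.sqrt_le_sqrt h

/-- `e^n` between the powers of the nine-digit envelopes of `e`. [folklore] -/
private theorem exp_nat_bounds (n : ℕ) :
    (2.7182818283 : ℝ) ^ n ≤ Real.exp n ∧ Real.exp n ≤ (2.7182818286 : ℝ) ^ n := by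
  rw [← Real.exp_one_pow]
  exact ⟨pow_le_pow_left₀ (by norm_num) Real.exp_one_gt_d9.le n,
    pow_le_pow_left₀ (Real.exp_pos 1).le Real.exp_one_lt_d9.le n⟩

/-- `e² ≤ 7.38906`. [folklore] -/
private theorem exp_two_le : Real.exp 2 ≤ 7.38906 := by
  have h := (exp_nat_bounds 2).2; norm_num at h ⊢; linarith

/-- `e⁵ ≤ 148.42`. [folklore] -/
private theorem exp_five_le : Real.exp 5 ≤ 148.42 := by
  have h := (exp_nat_bounds 5).2; norm_num at h ⊢; linarith

/-- `e⁶ ≤ 403.43`. [folklore] -/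
private theorem exp_six_le : Real.exp 6 ≤ 403.43 := by
  have h := (exp_nat_bounds 6).2; norm_num at h ⊢; linarith

/-! ### The optimisation in `Y` -/

/-- For `A x ≥ 8` and `A ≤ 2x` the integer `Y = ⌊√(Ax/2)⌋` satisfies `2 ≤ Y ≤ x` and
`A/(Y+1) + 2Y/x ≤ 2√(2A/x)`. [folklore] -/
private theorem exists_floor_le_two_sqrt {A x : ℝ} (hx : 0 < x) (hAx : 16 ≤ 2 * A * x)
    (hA2x : A ≤ 2 * x) :
    ∃ Y : ℕ, 2 ≤ Y ∧ (Y : ℝ) ≤ x ∧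
      A / ((Y : ℝ) + 1) + 2 * (Y : ℝ) / x ≤ 2 * Real.sqrt (2 * A / x) := by
  have hA0 : 0 < A := by nlinarith
  set t := Real.sqrt (2 * A / x) with ht
  have ht0 : 0 < t := Real.sqrt_pos.mpr (by positivity)
  have htsq : t ^ 2 = 2 * A / x := Real.sq_sqrt (by positivity)
  have hxne := hx.ne'
  have htne := ht0.ne'
  have hAt : A = x * t ^ 2 / 2 := by rw [htsq]; field_simp
  set s := x * t / 2 with hs
  have hs0 : 0 < s := by positivity
  have ht2 : t ≤ 2 := by
    have h1 : t ^ 2 ≤ 4 := by rw [htsq, div_le_iff₀ hx]; linarith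
    nlinarith
  have hsx : s ≤ x := by rw [hs]; nlinarith
  have hs2 : (2 : ℝ) ≤ s := by
    have h1 : (x * t) ^ 2 = 2 * A * x := by rw [mul_pow, htsq]; field_simp
    have h2 : 0 ≤ x * t := by positivity
    have hxt : 4 ≤ x * t := by nlinarith
    rw [hs]; linarith
  refine ⟨⌊s⌋₊, Nat.le_floor (by exact_mod_cast hs2), (Nat.floor_le hs0.le).trans hsx, ?_⟩
  have hY1 : s < (⌊s⌋₊ : ℝ) + 1 := Nat.lt_floor_add_one s
  have hYs : (⌊s⌋₊ : ℝ) ≤ s := Nat.floor_le hs0.le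
  have h1 : A / ((⌊s⌋₊ : ℝ) + 1) ≤ A / s := div_le_div_of_nonneg_left hA0.le hs0 hY1.le
  have h2 : A / s = t := by rw [hAt, hs]; field_simp
  have h3 : 2 * (⌊s⌋₊ : ℝ) / x ≤ 2 * s / x := by gcongr
  have h4 : 2 * s / x = t := by rw [hs]; field_simp
  linarith

/-! ### The trivial interval bound `|Σ_{a<n≤b} χ(n)| ≤ D/2` -/

/-- For `χ ≠ χ₀` mod `q`: `‖Σ_{a < n ≤ b} χ(n)‖ ≤ q/2` (a block of `q` consecutive values sums to `0`,
so an interval sum is a sum of at most `q/2` roots of unity up to sign). [folklore] -/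
private theorem norm_sum_Ioc_le_half {q : ℕ} [NeZero q] (χ : DirichletCharacter ℂ q) (hχ : χ ≠ 1)
    (a b : ℕ) : ‖∑ k ∈ Ioc a b, χ (k : ZMod q)‖ ≤ (q : ℝ) / 2 := by
  have hq := NeZero.pos q
  -- interval sums as differences of the partial sums `S`
  have hSsub : ∀ m n : ℕ, m ≤ n → DirichletAbel.partialSum χ n - DirichletAbel.partialSum χ m =
      ∑ k ∈ Ioc m n, χ (k : ZMod q) := by
    intro m n hmn
    rw [DirichletAbel.partialSum_eq_sum_Ioc, DirichletAbel.partialSum_eq_sum_Ioc, zero_add, zero_add,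
      ← Finset.sum_Ioc_consecutive _ (Nat.zero_le m) hmn]
    ring
  have htriv : ∀ m n : ℕ, ‖∑ k ∈ Ioc m n, χ (k : ZMod q)‖ ≤ ((n - m : ℕ) : ℝ) := by
    intro m n
    refine (norm_sum_le _ _).trans ?_
    have h : ∑ k ∈ Ioc m n, ‖χ (k : ZMod q)‖ ≤ ∑ k ∈ Ioc m n, (1 : ℝ) :=
      sum_le_sum fun k _ => χ.norm_le_one _
    refine h.trans ?_
    rw [sum_const, Nat.card_Ioc, nsmul_eq_mul, mul_one]
  have hper : ∀ m k : ℕ, DirichletAbel.partialSum χ (m + q * k) = DirichletAbel.partialSum χ m := by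
    intro m k
    induction k with
    | zero => simp
    | succ k ih => rw [Nat.mul_succ, ← add_assoc, DirichletAbel.partialSum_add_level χ hχ, ih]
  have hmod : ∀ n : ℕ, DirichletAbel.partialSum χ n = DirichletAbel.partialSum χ (n % q) := fun n => by
    conv_lhs => rw [← Nat.mod_add_div n q]
    exact hper _ _
  -- short intervals
  have hclaim : ∀ m n : ℕ, m ≤ n → n ≤ m + q →
      ‖DirichletAbel.partialSum χ n - DirichletAbel.partialSum χ m‖ ≤ (q : ℝ) / 2 := by
    intro m n hmn hnm
    rcases le_or_gt (2 * (n - m)) q with h | h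
    · rw [hSsub m n hmn]
      refine (htriv m n).trans ?_
      have h' : (2 : ℝ) * ((n - m : ℕ) : ℝ) ≤ q := by exact_mod_cast h
      linarith
    · have e : DirichletAbel.partialSum χ n - DirichletAbel.partialSum χ m =
          -(DirichletAbel.partialSum χ (m + q) - DirichletAbel.partialSum χ n) := by
        rw [DirichletAbel.partialSum_add_level χ hχ]; ring
      rw [e, norm_neg, hSsub n (m + q) hnm]
      refine (htriv n (m + q)).trans ?_
      have h1 : 2 * (m + q - n) ≤ q := by omega
      have h' : (2 : ℝ) * ((m + q - n : ℕ) : ℝ) ≤ q := by exact_mod_cast h1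
      linarith
  rcases le_or_gt a b with hab | hab
  · rw [← hSsub a b hab, hmod b, hmod a]
    have ha := Nat.mod_lt a hq
    have hb := Nat.mod_lt b hq
    rcases le_or_gt (a % q) (b % q) with h | h
    · exact hclaim _ _ h (by omega)
    · have e : DirichletAbel.partialSum χ (b % q) - DirichletAbel.partialSum χ (a % q) =
          DirichletAbel.partialSum χ (b % q + q) - DirichletAbel.partialSum χ (a % q) := by
        rw [DirichletAbel.partialSum_add_level χ hχ]
      rw [e]
      exact hclaim _ _ (by omega) (by omega)
  · rw [Finset.Ioc_eq_empty_of_le hab.le, sum_empty, norm_zero]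
    positivity

/-! ### Small levels -/

/-- A non-principal character has level `≥ 3`. [folklore] -/
private theorem three_le_of_ne_one {D : ℕ} [NeZero D] {χ : DirichletCharacter ℂ D} (hne : χ ≠ 1) :
    3 ≤ D := by
  by_contra hlt
  have hlt : D < 3 := not_le.mp hlt
  have hD0 : D ≠ 0 := NeZero.ne D
  interval_cases D
  · exact hD0 rfl
  · exact hne (DirichletCharacter.level_one χ)
  · apply hne
    refine MulChar.ext fun a => ?_
    have ha : a = 1 := by revert a; decide
    subst ha
    simp

/-! ### The sum `Σ g(n)/n` as a real part -/

/-- `Σ_{n ≤ x} g(n)/n = Re Σ_{n ≤ x} (Σ_{d∣n} χ(d))/n`. [folklore] -/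
private theorem gSum_eq_re {D : ℕ} [NeZero D] (χ : DirichletCharacter ℂ D) (x : ℝ) :
    gSum χ x = (∑ n ∈ Icc 1 ⌊x⌋₊, (∑ d ∈ n.divisors, χ (d : ZMod D)) / (n : ℂ)).re := by
  simp only [gSum, g, Complex.re_sum, Complex.div_natCast_re]

/-! ### `√D log D log x ≤ 0.625 x` in the printed range -/

/-- For `D ≥ 3` and `x ≥ 4√D log²D`: `√D log D · log x ≤ 0.625 x`
(`log x ≤ log x₀ + x/x₀ − 1`, `log x₀ = log 4 + ½ log D + 2 log log D ≤ 2.5 log D − 0.61`). [folklore] -/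
private theorem sqrt_mul_log_mul_log_le {D : ℕ} (hD : 3 ≤ D) {x : ℝ}
    (hx : 4 * Real.sqrt D * Real.log D ^ 2 ≤ x) :
    Real.sqrt D * Real.log D * Real.log x ≤ 0.625 * x := by
  have hD0 : (0 : ℝ) < D := by exact_mod_cast (by omega : 0 < D)
  have hu1 : 1.0397 ≤ Real.log D := log_ge_of_three_le hD
  have hu0 : 0 < Real.log D := by linarith
  have hv0 : 0 < Real.sqrt D := Real.sqrt_pos.mpr hD0
  have hx₀0 : 0 < 4 * Real.sqrt D * Real.log D ^ 2 := by positivity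
  have hx0 : 0 < x := lt_of_lt_of_le hx₀0 hx
  -- `log x ≤ log x₀ + x/x₀ − 1`
  have hlogx : Real.log x ≤ Real.log (4 * Real.sqrt D * Real.log D ^ 2) +
      x / (4 * Real.sqrt D * Real.log D ^ 2) - 1 := by
    have h := Real.log_le_sub_one_of_pos (div_pos hx0 hx₀0)
    rw [Real.log_div hx0.ne' hx₀0.ne'] at h
    linarith
  -- `log x₀ ≤ 2.5 log D − 0.6137`
  have hlogx₀ : Real.log (4 * Real.sqrt D * Real.log D ^ 2) ≤ 2.5 * Real.log D - 0.6137 := by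
    have e : Real.log (4 * Real.sqrt D * Real.log D ^ 2) =
        Real.log 4 + Real.log (Real.sqrt D) + 2 * Real.log (Real.log D) := by
      rw [Real.log_mul (by positivity) (by positivity), Real.log_mul (by norm_num) hv0.ne',
        Real.log_pow]
      push_cast; ring
    have h4 : Real.log 4 ≤ 1.3863 := by
      have : Real.log 4 = 2 * Real.log 2 := by
        rw [show (4 : ℝ) = 2 ^ 2 by norm_num, Real.log_pow]; push_cast; ring
      rw [this]; linarith [Real.log_two_lt_d9]
    have hvlog : Real.log (Real.sqrt D) = Real.log D / 2 := Real.log_sqrt hD0.le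
    have hulog : Real.log (Real.log D) ≤ Real.log D - 1 := Real.log_le_sub_one_of_pos hu0
    rw [e, hvlog]; linarith
  -- `√D log D · (4 log D) ≤ x`
  have hvu : Real.sqrt D * Real.log D * (4 * Real.log D) ≤ x := by nlinarith
  have hkey : Real.sqrt D * Real.log D * Real.log x ≤
      Real.sqrt D * Real.log D * (2.5 * Real.log D - 1.6137) + x / (4 * Real.log D) := by
    have h1 : Real.sqrt D * Real.log D * Real.log x ≤ Real.sqrt D * Real.log D *
        (Real.log (4 * Real.sqrt D * Real.log D ^ 2) + x / (4 * Real.sqrt D * Real.log D ^ 2) - 1) :=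
      mul_le_mul_of_nonneg_left hlogx (by positivity)
    have h2 : Real.sqrt D * Real.log D * (x / (4 * Real.sqrt D * Real.log D ^ 2)) =
        x / (4 * Real.log D) := by
      field_simp
    have h3 : Real.sqrt D * Real.log D * (Real.log (4 * Real.sqrt D * Real.log D ^ 2) - 1) ≤
        Real.sqrt D * Real.log D * (2.5 * Real.log D - 1.6137) :=
      mul_le_mul_of_nonneg_left (by linarith) (by positivity)
    calc Real.sqrt D * Real.log D * Real.log x
        ≤ Real.sqrt D * Real.log D * (Real.log (4 * Real.sqrt D * Real.log D ^ 2) +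
            x / (4 * Real.sqrt D * Real.log D ^ 2) - 1) := h1
      _ = Real.sqrt D * Real.log D * (Real.log (4 * Real.sqrt D * Real.log D ^ 2) - 1) +
            Real.sqrt D * Real.log D * (x / (4 * Real.sqrt D * Real.log D ^ 2)) := by ring
      _ ≤ Real.sqrt D * Real.log D * (2.5 * Real.log D - 1.6137) + x / (4 * Real.log D) := by
            rw [h2]; linarith
  have hpos : 0 ≤ 2.5 * Real.log D - 1.6137 := by linarith
  have h4 : Real.sqrt D * Real.log D * (2.5 * Real.log D - 1.6137) ≤
      x / (4 * Real.log D) * (2.5 * Real.log D - 1.6137) := by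
    apply mul_le_mul_of_nonneg_right _ hpos
    rw [le_div_iff₀ (by positivity)]; exact hvu
  have h5 : x / (4 * Real.log D) * (2.5 * Real.log D - 1.6137) + x / (4 * Real.log D) =
      0.625 * x - 0.6137 * x / (4 * Real.log D) := by
    field_simp; ring
  have h6 : 0 ≤ 0.6137 * x / (4 * Real.log D) := by positivity
  linarith [hkey, h4, h5, h6]

/-! ### The regime `D ≤ 69`: `P = D/2` -/

/-- Numerical kernel of the regime `P = D/2`: with `√D ≤ s₂`, `l₁ ≤ log D`, `L ≥ Lm ≥ 0` and the two
checks `4s₂(2Lm + 5/3) ≤ 25 l₁ Lm`, `8s₂ ≤ 25 l₁`: `8(D/2)(2L + 5/3) ≤ 25 √D log D · L`. [folklore] -/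
private theorem main_half {v u L s₂ l₁ Lm : ℝ} (hv : 0 ≤ v) (hvs : v ≤ s₂) (hl₁ : l₁ ≤ u)
    (hLm0 : 0 ≤ Lm) (hLm : Lm ≤ L)
    (hb1 : 4 * s₂ * (2 * Lm + 5 / 3) ≤ 25 * l₁ * Lm) (hb2 : 8 * s₂ ≤ 25 * l₁) :
    8 * (v * v / 2) * (2 * L + 5 / 3) ≤ 25 * (v * u) * L := by
  have hL0 : 0 ≤ L := hLm0.trans hLm
  have h0 : 8 * s₂ * (L - Lm) ≤ 25 * l₁ * (L - Lm) :=
    mul_le_mul_of_nonneg_right hb2 (sub_nonneg.mpr hLm)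
  have h1 : 4 * s₂ * (2 * L + 5 / 3) ≤ 25 * l₁ * L := by linarith
  have h2 : 25 * l₁ * L ≤ 25 * u * L := by
    have := mul_le_mul_of_nonneg_right hl₁ hL0
    linarith
  have h3 : 4 * v * (2 * L + 5 / 3) ≤ 4 * s₂ * (2 * L + 5 / 3) := by
    have : 0 ≤ 2 * L + 5 / 3 := by linarith
    nlinarith
  calc 8 * (v * v / 2) * (2 * L + 5 / 3) = v * (4 * v * (2 * L + 5 / 3)) := by ring
    _ ≤ v * (25 * u * L) := mul_le_mul_of_nonneg_left (by linarith) hv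
    _ = 25 * (v * u) * L := by ring

/-- The regime `3 ≤ D ≤ 69`: `2 ≤ log x` and `8(D/2)(2 log x + 5/3) ≤ 25√D log D log x` for
`x ≥ 4√D log²D` (five numerical ranges). [folklore] -/
private theorem half_regime {D : ℕ} (hD3 : 3 ≤ D) (hD69 : D ≤ 69) {x : ℝ}
    (hx : 4 * Real.sqrt D * Real.log D ^ 2 ≤ x) :
    2 ≤ Real.log x ∧
      8 * ((D : ℝ) / 2) * (2 * Real.log x + 5 / 3) ≤ 25 * (Real.sqrt D * Real.log D) * Real.log x := by
  have hD0 : (0 : ℝ) < D := by exact_mod_cast (by omega : 0 < D)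
  have hDr : (3 : ℝ) ≤ D := by exact_mod_cast hD3
  have hv0 : 0 ≤ Real.sqrt D := Real.sqrt_nonneg _
  have hu1 : 1.0397 ≤ Real.log D := log_ge_of_three_le hD3
  have hDvv : (D : ℝ) / 2 = Real.sqrt D * Real.sqrt D / 2 := by rw [Real.mul_self_sqrt hD0.le]
  have hx0 : 0 < x := by
    have : 0 < 4 * Real.sqrt D * Real.log D ^ 2 := by
      have := Real.sqrt_pos.mpr hD0; have : 0 < Real.log D := by linarith
      positivity
    linarith
  -- `Lm ≤ log x` from numeric lower bounds `s₁ ≤ √D`, `l₁ ≤ log D`, `e^{Lm} ≤ 4 s₁ l₁²`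
  have hLge : ∀ {s₁ l₁ Lm : ℝ}, 0 ≤ s₁ → 0 ≤ l₁ → s₁ ≤ Real.sqrt D → l₁ ≤ Real.log D →
      Real.exp Lm ≤ 4 * s₁ * l₁ ^ 2 → Lm ≤ Real.log x := by
    intro s₁ l₁ Lm hs0 hl0 hs hl he
    rw [Real.le_log_iff_exp_le hx0]
    refine he.trans (le_trans ?_ hx)
    have h1 : l₁ ^ 2 ≤ Real.log D ^ 2 := pow_le_pow_left₀ hl0 hl 2
    calc 4 * s₁ * l₁ ^ 2 ≤ 4 * Real.sqrt D * l₁ ^ 2 := by gcongr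
      _ ≤ 4 * Real.sqrt D * Real.log D ^ 2 := by gcongr
  rw [hDvv]
  rcases le_or_gt D 4 with h4 | h4
  · -- `3 ≤ D ≤ 4`
    have hs1 : (1.732 : ℝ) ≤ Real.sqrt D := le_sqrt_of_sq_le (by norm_num) (by norm_num; linarith)
    have hs2 : Real.sqrt D ≤ 2 :=
      sqrt_le_of_le_sq (by norm_num) (by norm_num; exact_mod_cast h4)
    have hL : 2 ≤ Real.log x :=
      hLge (by norm_num) (by norm_num) hs1 hu1 (exp_two_le.trans (by norm_num))
    exact ⟨hL, main_half hv0 hs2 hu1 (by norm_num) hL (by norm_num) (by norm_num)⟩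
  rcases le_or_gt D 8 with h8 | h8
  · -- `5 ≤ D ≤ 8`
    have hDr' : (5 : ℝ) ≤ D := by exact_mod_cast h4
    have hs1 : (2.236 : ℝ) ≤ Real.sqrt D := le_sqrt_of_sq_le (by norm_num) (by norm_num; linarith)
    have hs2 : Real.sqrt D ≤ 2.8285 :=
      sqrt_le_of_le_sq (by norm_num) (by
        have : (D : ℝ) ≤ 8 := by exact_mod_cast h8
        norm_num; linarith)
    have hl1 : (1.3862 : ℝ) ≤ Real.log D := by
      have := log_ge_of_pow_le (k := 2) (D := D) (by omega)
      push_cast at this; linarith [Real.log_two_gt_d9]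
    have hL : 2 ≤ Real.log x :=
      hLge (by norm_num) (by norm_num) hs1 hl1 (exp_two_le.trans (by norm_num))
    exact ⟨hL, main_half hv0 hs2 hl1 (by norm_num) hL (by norm_num) (by norm_num)⟩
  rcases le_or_gt D 16 with h16 | h16
  · -- `9 ≤ D ≤ 16`
    have hDr' : (9 : ℝ) ≤ D := by exact_mod_cast h8
    have hs1 : (3 : ℝ) ≤ Real.sqrt D := le_sqrt_of_sq_le (by norm_num) (by norm_num; linarith)
    have hs2 : Real.sqrt D ≤ 4 :=
      sqrt_le_of_le_sq (by norm_num) (by norm_num; exact_mod_cast h16)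
    have hl1 : (2.0794 : ℝ) ≤ Real.log D := by
      have := log_ge_of_pow_le (k := 3) (D := D) (by omega)
      push_cast at this; linarith [Real.log_two_gt_d9]
    have hL : 2 ≤ Real.log x :=
      hLge (by norm_num) (by norm_num) hs1 hl1 (exp_two_le.trans (by norm_num))
    exact ⟨hL, main_half hv0 hs2 hl1 (by norm_num) hL (by norm_num) (by norm_num)⟩
  rcases le_or_gt D 32 with h32 | h32
  · -- `17 ≤ D ≤ 32`
    have hDr' : (17 : ℝ) ≤ D := by exact_mod_cast h16
    have hs1 : (4.123 : ℝ) ≤ Real.sqrt D := le_sqrt_of_sq_le (by norm_num) (by norm_num; linarith)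
    have hs2 : Real.sqrt D ≤ 5.657 :=
      sqrt_le_of_le_sq (by norm_num) (by
        have : (D : ℝ) ≤ 32 := by exact_mod_cast h32
        norm_num; linarith)
    have hl1 : (2.7725 : ℝ) ≤ Real.log D := by
      have := log_ge_of_pow_le (k := 4) (D := D) (by omega)
      push_cast at this; linarith [Real.log_two_gt_d9]
    have hL : 2 ≤ Real.log x :=
      hLge (by norm_num) (by norm_num) hs1 hl1 (exp_two_le.trans (by norm_num))
    exact ⟨hL, main_half hv0 hs2 hl1 (by norm_num) hL (by norm_num) (by norm_num)⟩
  · -- `33 ≤ D ≤ 69`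
    have hDr' : (33 : ℝ) ≤ D := by exact_mod_cast h32
    have hs1 : (5.744 : ℝ) ≤ Real.sqrt D := le_sqrt_of_sq_le (by norm_num) (by norm_num; linarith)
    have hs2 : Real.sqrt D ≤ 8.307 :=
      sqrt_le_of_le_sq (by norm_num) (by
        have : (D : ℝ) ≤ 69 := by exact_mod_cast hD69
        norm_num; linarith)
    have hl1 : (3.4657 : ℝ) ≤ Real.log D := by
      have := log_ge_of_pow_le (k := 5) (D := D) (by omega)
      push_cast at this; linarith [Real.log_two_gt_d9]
    have hL : 5 ≤ Real.log x :=
      hLge (by norm_num) (by norm_num) hs1 hl1 (exp_five_le.trans (by norm_num))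
    exact ⟨by linarith, main_half hv0 hs2 hl1 (by norm_num) hL (by norm_num) (by norm_num)⟩

/-! ### The regime `D ≥ 70`: explicit Pólya–Vinogradov with the constant `1/π` -/

/-- `√D log D/π + 2√D log log D/π + 2√D + 1 ≤ √D(0.5527 log D + 2.125)` for `√D ≥ 8`, `log D ≥ 1`
(`1/π ≤ 0.3184`, `log u ≤ u/e ≤ 0.3679u`). [folklore] -/
private theorem pv_bound_le {v u : ℝ} (hv : 8 ≤ v) (hu : 1 ≤ u) :
    v * u / Real.pi + 2 * v * Real.log u / Real.pi + 2 * v + 1 ≤ v * (0.5527 * u + 2.125) := by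
  have hπ := Real.pi_gt_d4
  have hv0 : 0 < v := by linarith
  have hu0 : 0 < u := by linarith
  have hvu : 0 < v * u := mul_pos hv0 hu0
  have hlog : Real.log u ≤ 0.3679 * u := by
    have h1 : Real.log u ≤ Real.exp (Real.log u - 1) := by
      have := Real.add_one_le_exp (Real.log u - 1); linarith
    rw [Real.exp_sub, Real.exp_log hu0] at h1
    have h2 : u / Real.exp 1 ≤ 0.3679 * u := by
      rw [div_le_iff₀ (Real.exp_pos 1)]; nlinarith [Real.exp_one_gt_d9]
    linarith
  have h1 : v * u / Real.pi ≤ 0.3184 * (v * u) := by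
    rw [div_le_iff₀ Real.pi_pos]; nlinarith
  have h2 : 2 * v * Real.log u / Real.pi ≤ 0.2343 * (v * u) := by
    rw [div_le_iff₀ Real.pi_pos]
    have : 2 * v * Real.log u ≤ 2 * v * (0.3679 * u) := by nlinarith
    nlinarith
  have h3 : (1 : ℝ) ≤ 0.125 * v := by linarith
  linarith

/-- Numerical kernel of the regime `D ≥ 70`: `8P(2L + 5/3) ≤ 25 √D log D · L` for `√D ≥ 8`,
`log D ≥ 4.1588`, `L ≥ 6` and `P` the `1/π`-Pólya–Vinogradov bound. [folklore] -/
private theorem main_pv {v u L P : ℝ} (hv : 8 ≤ v) (hu : 4.1588 ≤ u) (hL : 6 ≤ L)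
    (hP : P ≤ v * u / Real.pi + 2 * v * Real.log u / Real.pi + 2 * v + 1) :
    8 * P * (2 * L + 5 / 3) ≤ 25 * (v * u) * L := by
  have hP1 := hP.trans (pv_bound_le hv (by linarith))
  have hv0 : 0 < v := by linarith
  have hg : 8 * (0.5527 * u + 2.125) * (2 * L + 5 / 3) ≤ 25 * u * L := by
    nlinarith [mul_nonneg (sub_nonneg.2 hu) (sub_nonneg.2 hL)]
  have h1 : 8 * P * (2 * L + 5 / 3) ≤ 8 * (v * (0.5527 * u + 2.125)) * (2 * L + 5 / 3) := by
    have : 0 ≤ 2 * L + 5 / 3 := by linarith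
    nlinarith
  calc 8 * P * (2 * L + 5 / 3) ≤ 8 * (v * (0.5527 * u + 2.125)) * (2 * L + 5 / 3) := h1
    _ = v * (8 * (0.5527 * u + 2.125) * (2 * L + 5 / 3)) := by ring
    _ ≤ v * (25 * u * L) := mul_le_mul_of_nonneg_left hg hv0.le
    _ = 25 * (v * u) * L := by ring

/-- The regime `D ≥ 70` for a primitive character: the `1/π`-Pólya–Vinogradov bound `P` of the tree
bounds all interval sums, `P ≥ 3/2`, `log x ≥ 2` and `8P(2 log x + 5/3) ≤ 25 √D log D log x`.
[cite: Pomerance2011, §1 (2)] -/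
private theorem pv_regime {D : ℕ} [NeZero D] {χ : DirichletCharacter ℂ D} (hprim : χ.IsPrimitive)
    (hD70 : 70 ≤ D) {x : ℝ} (hx : 4 * Real.sqrt D * Real.log D ^ 2 ≤ x) :
    ∃ P : ℝ, (∀ a b : ℕ, ‖∑ k ∈ Ioc a b, χ (k : ZMod D)‖ ≤ P) ∧ 3 / 2 ≤ P ∧ 2 ≤ Real.log x ∧
      8 * P * (2 * Real.log x + 5 / 3) ≤ 25 * (Real.sqrt D * Real.log D) * Real.log x := by
  have hD0 : (0 : ℝ) < D := by exact_mod_cast (by omega : 0 < D)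
  have hDr : (70 : ℝ) ≤ D := by exact_mod_cast hD70
  have hs1 : (8.366 : ℝ) ≤ Real.sqrt D := le_sqrt_of_sq_le (by norm_num) (by norm_num; linarith)
  have hv8 : (8 : ℝ) ≤ Real.sqrt D := le_trans (by norm_num) hs1
  have hl1 : (4.1588 : ℝ) ≤ Real.log D := by
    have := log_ge_of_pow_le (k := 6) (D := D) (by omega)
    push_cast at this; linarith [Real.log_two_gt_d9]
  have hx0 : 0 < x := by
    have : 0 < 4 * Real.sqrt D * Real.log D ^ 2 := by
      have : 0 < Real.sqrt D := by linarith
      have : 0 < Real.log D := by linarith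
      positivity
    linarith
  have hL : 6 ≤ Real.log x := by
    rw [Real.le_log_iff_exp_le hx0]
    refine exp_six_le.trans (le_trans ?_ hx)
    have h1 : (4.1588 : ℝ) ^ 2 ≤ Real.log D ^ 2 := pow_le_pow_left₀ (by norm_num) hl1 2
    have h2 : (403.43 : ℝ) ≤ 4 * 8.366 * 4.1588 ^ 2 := by norm_num
    refine h2.trans ?_
    calc (4 : ℝ) * 8.366 * 4.1588 ^ 2 ≤ 4 * Real.sqrt D * 4.1588 ^ 2 := by gcongr
      _ ≤ 4 * Real.sqrt D * Real.log D ^ 2 := by gcongr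
  refine ⟨Real.sqrt D * Real.log D / Real.pi + 2 * Real.sqrt D * Real.log (Real.log D) / Real.pi +
    2 * Real.sqrt D + 1, ?_, ?_, by linarith, ?_⟩
  · intro a b
    rcases le_or_gt a b with hab | hab
    · obtain ⟨k, rfl⟩ := Nat.exists_eq_add_of_le hab
      exact Literature.NumberTheory.Sieve.LargeSieve.polyaVinogradov_one_div_pi (by omega) hprim a k
    · have h := Literature.NumberTheory.Sieve.LargeSieve.polyaVinogradov_one_div_pi (q := D)
        (by omega) hprim a 0
      rw [add_zero, Finset.Ioc_self, sum_empty, norm_zero] at h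
      rw [Finset.Ioc_eq_empty_of_le hab.le, sum_empty, norm_zero]
      exact h
  · have hlog1 : 1 ≤ Real.log D := by linarith
    have hloglog : 0 ≤ Real.log (Real.log D) := Real.log_nonneg hlog1
    have h1 : 0 ≤ Real.sqrt D * Real.log D / Real.pi := by positivity
    have h2 : 0 ≤ 2 * Real.sqrt D * Real.log (Real.log D) / Real.pi := by positivity
    linarith
  · exact main_pv hv8 hl1 hL
      (le_refl (Real.sqrt D * Real.log D / Real.pi + 2 * Real.sqrt D * Real.log (Real.log D) / Real.pi +
        2 * Real.sqrt D + 1))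

/-! ### Assembly -/

/-- The common final step: from an interval bound `P ≥ 3/2` with `8P(2 log x + 5/3) ≤ 25√D log D log x`
and `log x ≥ 2` (in the printed range) to Pintz's `5√(√D log D log x/x)`.
[cite: Pintz1976ElementaryII, Lemma 1 (proof, pp. 279–280)] -/
private theorem lemma1_of_interval_bound {D : ℕ} [NeZero D] (χ : DirichletCharacter ℂ D)
    (hχ : χ ≠ 1) (hD : 3 ≤ D) {P x : ℝ} (hPint : ∀ a b : ℕ, ‖∑ k ∈ Ioc a b, χ (k : ZMod D)‖ ≤ P)
    (hP32 : 3 / 2 ≤ P) (hx : 4 * Real.sqrt D * Real.log D ^ 2 ≤ x) (hL2 : 2 ≤ Real.log x)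
    (hmain : 8 * P * (2 * Real.log x + 5 / 3) ≤ 25 * (Real.sqrt D * Real.log D) * Real.log x) :
    |gSum χ x - (deriv χ.LFunction 1).re -
        (Real.log x + Real.eulerMascheroniConstant) * (χ.LFunction 1).re| ≤
      5 * Real.sqrt (Real.sqrt D * Real.log D * Real.log x / x) := by
  have hD0 : (0 : ℝ) < D := by exact_mod_cast (by omega : 0 < D)
  have hv0 : 0 < Real.sqrt D := Real.sqrt_pos.mpr hD0
  have hu0 : 0 < Real.log D := lt_of_lt_of_le (by norm_num) (log_ge_of_three_le hD)
  have hx0 : 0 < x := by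
    have : 0 < 4 * Real.sqrt D * Real.log D ^ 2 := by positivity
    linarith
  have hγ0 : 0 ≤ Real.eulerMascheroniConstant :=
    (by norm_num : (0 : ℝ) ≤ 1 / 2).trans Real.one_half_lt_eulerMascheroniConstant.le
  have hγ1 : Real.eulerMascheroniConstant < 2 / 3 := Real.eulerMascheroniConstant_lt_two_thirds
  have hP0 : 0 ≤ P := by linarith
  obtain ⟨A, hA⟩ : ∃ A : ℝ, A = P * (2 * Real.log x + Real.eulerMascheroniConstant + 1) := ⟨_, rfl⟩
  have hAle : A ≤ P * (2 * Real.log x + 5 / 3) := by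
    rw [hA]; exact mul_le_mul_of_nonneg_left (by linarith) hP0
  have hAge : 5 * P ≤ A := by
    rw [hA]
    have : (5 : ℝ) ≤ 2 * Real.log x + Real.eulerMascheroniConstant + 1 := by linarith
    nlinarith
  have h8A : 8 * A ≤ 25 * (Real.sqrt D * Real.log D) * Real.log x := by nlinarith
  have hBL := sqrt_mul_log_mul_log_le hD hx
  have hA2x : A ≤ 2 * x := by nlinarith
  have hx3 : 3 ≤ x := by
    have h1 : Real.exp 2 ≤ x := (Real.le_log_iff_exp_le hx0).mp hL2
    have h2 : (2 : ℝ) + 1 ≤ Real.exp 2 := Real.add_one_le_exp 2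
    linarith
  have hAx : 16 ≤ 2 * A * x := by nlinarith
  obtain ⟨Y, hY2, hYx, hopt⟩ := exists_floor_le_two_sqrt hx0 hAx hA2x
  have hFA := DirichletAbel.norm_sum_divisorSum_div_sub_le_interval_real χ hχ hPint hY2 hYx
  rw [← hA] at hFA
  -- `2√(2A/x) ≤ 5√(√D log D log x/x)`
  have hcmp : 2 * Real.sqrt (2 * A / x) ≤ 5 * Real.sqrt (Real.sqrt D * Real.log D * Real.log x / x) := by
    have e2 : (2 : ℝ) * Real.sqrt (2 * A / x) = Real.sqrt (2 ^ 2 * (2 * A / x)) := by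
      rw [Real.sqrt_mul (by norm_num) , Real.sqrt_sq (by norm_num)]
    have e5 : (5 : ℝ) * Real.sqrt (Real.sqrt D * Real.log D * Real.log x / x) =
        Real.sqrt (5 ^ 2 * (Real.sqrt D * Real.log D * Real.log x / x)) := by
      rw [Real.sqrt_mul (by norm_num), Real.sqrt_sq (by norm_num)]
    rw [e2, e5]
    refine Real.sqrt_le_sqrt ?_
    rw [show (2 : ℝ) ^ 2 * (2 * A / x) = (8 * A) / x by ring,
      show (5 : ℝ) ^ 2 * (Real.sqrt D * Real.log D * Real.log x / x) =
        (25 * (Real.sqrt D * Real.log D) * Real.log x) / x by ring]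
    exact div_le_div_of_nonneg_right h8A hx0.le
  -- the target is the real part of the complex difference
  have hre : gSum χ x - (deriv χ.LFunction 1).re -
      (Real.log x + Real.eulerMascheroniConstant) * (χ.LFunction 1).re =
      ((∑ n ∈ Icc 1 ⌊x⌋₊, (∑ d ∈ n.divisors, χ (d : ZMod D)) / (n : ℂ)) -
        (((Real.log x + Real.eulerMascheroniConstant : ℝ) : ℂ) * χ.LFunction 1 +
          deriv χ.LFunction 1)).re := by
    rw [gSum_eq_re, Complex.sub_re, Complex.add_re, Complex.re_ofReal_mul]; ring
  rw [hre]
  exact (Complex.abs_re_le_norm _).trans (hFA.trans (hopt.trans hcmp))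

/-- **Pintz 1976 (II), Lemma 1 — PROVED** (discharge of the named fact `pintz1976_lemma1`): for a
primitive real character `χ ≠ χ₀` mod `D` and every `x ≥ 4√D log²D`,
`|Σ_{n ≤ x} g(n)/n − L'(1) − (log x + γ)L(1)| ≤ 5√(√D log D log x/x)`.
[cite: Pintz1976ElementaryII, Lemma 1 p. 279 (2.1)] -/
theorem pintz1976_lemma1_holds : pintz1976_lemma1 := by
  intro D _ χ _hquad hprim hne x hx
  have hD3 : 3 ≤ D := three_le_of_ne_one hne
  by_cases hD69 : D ≤ 69
  · obtain ⟨hL, hmain⟩ := half_regime hD3 hD69 hx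
    have hP32 : (3 : ℝ) / 2 ≤ (D : ℝ) / 2 := by
      have : (3 : ℝ) ≤ D := by exact_mod_cast hD3
      linarith
    exact lemma1_of_interval_bound χ hne hD3 (norm_sum_Ioc_le_half χ hne) hP32 hx hL hmain
  · have hD70 : 70 ≤ D := by omega
    obtain ⟨P, hPint, hP32, hL, hmain⟩ := pv_regime hprim hD70 hx
    exact lemma1_of_interval_bound χ hne hD3 hPint hP32 hx hL hmain

end Literature.NumberTheory.LFunctions

end
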